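import Mathlib.Analysis.InnerProductSpace.PiL2

/-!
# `StrictSplittingRule` (stmt-AtomisticToContinuum-12560): the discrete IMS localisation formula for bond forms

Route `FreeSplittingCertificates`, crux r3 `StrictSplittingRule`, line `registered` (unit b2b-freesplit-B, gen 6).
The Korn half of the far lemma of the H12⋆ architecture (HOME CERT.md §15, FAR-LEMMA-SPEC §5 (g)) is scale-uniform on DOUBLY
PINNED dyadic shells (numerically K_w ≈ 9, t* ≤ 0.065 on every shell `(2ᵏL, 2ᵏ⁺¹L]`), so the natural proof LOCALISES the field with
a lattice partition of unity `χ_k`, `Σ_k χ_k(x)² = 1`.  Every term of the far form is a BOND FORM: a weighted square of a difference of scalars read at the two ends of a bond (`p = ⟪e_b, v⟫` for stretches, a coordinate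
of `v` for full differences), and for such forms the localisation error is EXACT (the discrete Ismagilov–Morgan–Simon formula):

* `ims_edge` — for reals `p, q` and weights `a_k = χ_k(x)`, `b_k = χ_k(y)` with `Σ a_k² = 1 = Σ b_k²`:
  `Σ_k (b_k q − a_k p)² = (q − p)² + p q · Σ_k (a_k − b_k)²`;
* `ims_edge_le` — hence `Σ_k (b_k q − a_k p)² ≤ (q − p)² + ½(p² + q²)·Σ_k (a_k − b_k)²` and the reverse bound
  `(q − p)² ≤ Σ_k (b_k q − a_k p)² + ½(p² + q²)·Σ_k (a_k − b_k)²`;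
* `ims_sum_le` / `ims_sum_ge` — summed over a finite family of bonds with nonnegative weights: the localised forms and the global form
  differ by at most `½ Σ_b c_b (p_{x_b}² + p_{y_b}²)·Σ_k (χ_k(x_b) − χ_k(y_b))²` — a POTENTIAL term of size `|∇χ|²·|v|²`, which on dyadic
  cut-offs is `O(r⁻²)|v|²` and is paid by the Hardy bricks (`…HcpExteriorHardy.lean`).

Structural bookkeeping ([folklore]); VALUE = a kernel-checked brick — NOT summit progress.
-/

namespace Summit.AtomisticToContinuum.Crystallization.Theorems.StrictSplittingRuleBirth

open scoped BigOperators

/-- **IMS on one bond**: `Σ_k (b_k q − a_k p)² = (q − p)² + p q Σ_k (a_k − b_k)²` when `Σ a_k² = Σ b_k² = 1`. [folklore] -/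
theorem ims_edge {ι : Type*} (K : Finset ι) (a b : ι → ℝ) (p q : ℝ) (ha : ∑ k ∈ K, a k ^ 2 = 1)
    (hb : ∑ k ∈ K, b k ^ 2 = 1) :
    ∑ k ∈ K, (b k * q - a k * p) ^ 2 = (q - p) ^ 2 + p * q * ∑ k ∈ K, (a k - b k) ^ 2 := by
  have e1 : ∑ k ∈ K, (b k * q - a k * p) ^ 2 =
      q ^ 2 * ∑ k ∈ K, b k ^ 2 + p ^ 2 * ∑ k ∈ K, a k ^ 2 - 2 * p * q * ∑ k ∈ K, a k * b k := by
    rw [Finset.mul_sum, Finset.mul_sum, Finset.mul_sum, ← Finset.sum_add_distrib, ← Finset.sum_sub_distrib]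
    exact Finset.sum_congr rfl fun k _ => by ring
  have e2 : ∑ k ∈ K, (a k - b k) ^ 2 = ∑ k ∈ K, a k ^ 2 + ∑ k ∈ K, b k ^ 2 - 2 * ∑ k ∈ K, a k * b k := by
    rw [Finset.mul_sum, ← Finset.sum_add_distrib, ← Finset.sum_sub_distrib]
    exact Finset.sum_congr rfl fun k _ => by ring
  rw [e1, e2, ha, hb]
  ring

/-- **IMS on one bond, two-sided bound**: the localisation error is at most `½(p² + q²) Σ_k (a_k − b_k)²`. [folklore] -/
theorem ims_edge_le {ι : Type*} (K : Finset ι) (a b : ι → ℝ) (p q : ℝ) (ha : ∑ k ∈ K, a k ^ 2 = 1)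
    (hb : ∑ k ∈ K, b k ^ 2 = 1) :
    ∑ k ∈ K, (b k * q - a k * p) ^ 2 ≤ (q - p) ^ 2 + (p ^ 2 + q ^ 2) / 2 * ∑ k ∈ K, (a k - b k) ^ 2 ∧
    (q - p) ^ 2 ≤ ∑ k ∈ K, (b k * q - a k * p) ^ 2 + (p ^ 2 + q ^ 2) / 2 * ∑ k ∈ K, (a k - b k) ^ 2 := by
  rw [ims_edge K a b p q ha hb]
  have hS : 0 ≤ ∑ k ∈ K, (a k - b k) ^ 2 := Finset.sum_nonneg fun k _ => sq_nonneg _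
  have h1 : p * q ≤ (p ^ 2 + q ^ 2) / 2 := by nlinarith [sq_nonneg (p - q)]
  have h2 : -((p ^ 2 + q ^ 2) / 2) ≤ p * q := by nlinarith [sq_nonneg (p + q)]
  constructor
  · nlinarith [mul_le_mul_of_nonneg_right h1 hS]
  · nlinarith [mul_le_mul_of_nonneg_right h2 hS]

/-- **IMS summed over bonds (upper bound)**: for a finite family of bonds `β` with weights `c ≥ 0`, endpoint values `p (x β)`,
`p (y β)` and cut-offs with `Σ_k χ_k(z)² = 1` at every endpoint:
`Σ_k Σ_β c_β (χ_k(y_β) p_{y_β} − χ_k(x_β) p_{x_β})² ≤ Σ_β c_β (p_{y_β} − p_{x_β})² + Σ_β c_β ½(p_{x_β}² + p_{y_β}²) Σ_k (χ_k(x_β) − χ_k(y_β))²`.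
[folklore] -/
theorem ims_sum_le {ι B V : Type*} (K : Finset ι) (S : Finset B) (x y : B → V) (c : B → ℝ) (p : V → ℝ) (χ : ι → V → ℝ)
    (hc : ∀ β ∈ S, 0 ≤ c β) (hχ : ∀ β ∈ S, ∑ k ∈ K, χ k (x β) ^ 2 = 1 ∧ ∑ k ∈ K, χ k (y β) ^ 2 = 1) :
    ∑ k ∈ K, ∑ β ∈ S, c β * (χ k (y β) * p (y β) - χ k (x β) * p (x β)) ^ 2 ≤
      ∑ β ∈ S, c β * (p (y β) - p (x β)) ^ 2 +
        ∑ β ∈ S, c β * ((p (x β) ^ 2 + p (y β) ^ 2) / 2 * ∑ k ∈ K, (χ k (x β) - χ k (y β)) ^ 2) := by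
  rw [Finset.sum_comm, ← Finset.sum_add_distrib]
  refine Finset.sum_le_sum fun β hβ => ?_
  rw [← Finset.mul_sum, ← mul_add]
  refine mul_le_mul_of_nonneg_left ?_ (hc β hβ)
  exact (ims_edge_le K (fun k => χ k (x β)) (fun k => χ k (y β)) (p (x β)) (p (y β)) (hχ β hβ).1 (hχ β hβ).2).1

/-- **IMS summed over bonds (lower bound)**: the global form is at most the sum of the localised forms plus the same potential term.
[folklore] -/
theorem ims_sum_ge {ι B V : Type*} (K : Finset ι) (S : Finset B) (x y : B → V) (c : B → ℝ) (p : V → ℝ) (χ : ι → V → ℝ)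
    (hc : ∀ β ∈ S, 0 ≤ c β) (hχ : ∀ β ∈ S, ∑ k ∈ K, χ k (x β) ^ 2 = 1 ∧ ∑ k ∈ K, χ k (y β) ^ 2 = 1) :
    ∑ β ∈ S, c β * (p (y β) - p (x β)) ^ 2 ≤
      ∑ k ∈ K, ∑ β ∈ S, c β * (χ k (y β) * p (y β) - χ k (x β) * p (x β)) ^ 2 +
        ∑ β ∈ S, c β * ((p (x β) ^ 2 + p (y β) ^ 2) / 2 * ∑ k ∈ K, (χ k (x β) - χ k (y β)) ^ 2) := by
  rw [Finset.sum_comm, ← Finset.sum_add_distrib]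
  refine Finset.sum_le_sum fun β hβ => ?_
  rw [← Finset.mul_sum, ← mul_add]
  refine mul_le_mul_of_nonneg_left ?_ (hc β hβ)
  exact (ims_edge_le K (fun k => χ k (x β)) (fun k => χ k (y β)) (p (x β)) (p (y β)) (hχ β hβ).1 (hχ β hβ).2).2

end Summit.AtomisticToContinuum.Crystallization.Theorems.StrictSplittingRuleBirth
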